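import Literature.NumberTheory.LFunctions.Zhang2022.RepairSection18Closed
import Literature.NumberTheory.LFunctions.Zhang2022.RepairCoverFrame
import Literature.NumberTheory.LFunctions.Zhang2022.MainTermFormCauchySchwarz
import Literature.NumberTheory.LFunctions.Zhang2022.Section2AllIota

/-!
# Zhang (2022) §18-margin repair rung: the Q2 ASSEMBLY shapes — (§1) STRUCTURAL: dictionary
# identities + Cauchy–Schwarz ⇒ `∀ θ ∈ R, ¬ (C₂₃₂C₂₃₃ < |𝔡′+𝔡|²)`; (§2) LOCAL ANNEX: certified cover
# ⇒ `∀ θ ∈ R ∩ K, m₀ ≤ C₂₃₂(θ)`, `¬ Margin232T θ`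

Trunk T-ANT (NumberTheory/LFunctions). Y. Zhang, *Discrete mean estimates and the Landau–Siegel
zero*, arXiv:2211.02515v1 (2022) [Zhang2022LandauSiegel] — **an unrefereed manuscript under
adjudication; nothing here asserts or denies its Theorems 1–2 or any analytic lemma; no claim about
Landau–Siegel zeros is made.** Rung F-S1R «§18-margin REPAIR-or-BARRIER» (D-0077), barrier side (Q2),
seat repair-p6 (ASSIGNMENTS.md v1: "the ASSEMBLY theorem of Q2 `not_repairable_in_class_of_cover`").

RULING R3 (sz-repair-plan 2026-08-26T04:24Z): the verdict currency is the JOINT criterion T-true and the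
Q2 architecture is STRUCTURAL (the Cauchy–Schwarz wall of the cell's ONE Hermitian form `𝔅`,
`MainTermFormCauchySchwarz`), the cover being a LOCAL ANNEX for the T-print/T-chain floors near `θ₀`.
§1 gives the structural assembly with the dictionary identities K-S1…K-S3 as hypotheses
(`not_trueNeed_of_domination`, `not_sqrt_closing_of_domination`; any parameter type `Θ`,
any class; p4's K-S4 STATEMENT `Repair.not_repairable_true_need_of_dictionary` in `RepairStructuralBarrier` is
the design-level instance with the three dictionary EQUALITIES over `AdmissibleTheta`); §2 the annex assembly. Both are SHAPES with every seat's deliverable as an explicit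
hypothesis, so that the final instantiation is a short file once the pieces land. For §2:

* the CLASS: any predicate `Adm : Theta → Prop` with real coordinates `coords : Theta → ℕ → ℝ`
  (p4's `AdmissibleTheta`, `Theta.coords`) and a coordinate-level region `R` implied by `Adm`
  (p4's `LinHolds admissibleLinCons`, used by the leaves' excluder);
* the FUNCTIONAL: p1's `C232T θ c₁ c₂` / `margin232LHS θ c₁ c₂` (`RepairSection18Theta`) fed with
  feeders `c1T c2T : Theta → ℂ` (p3's `𝔠₁(θ)`, `𝔠₂(θ)`) that ARE the Hermitian forms of coordinate-level
  entries `c11F … c34F : (ℕ → ℝ) → ℂ` (hypotheses `h1`, `h2` — the shape of p1's `C232T_form_re`), and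
  with p1's `ι`-free coefficients `F20T … F31T` (`R3T`, `R4T`) given as coordinate-level functions
  (`hF··`);
* the CERTIFICATE: p5's cover frame (`RepairCoverFrame`: `coverCheck (psdLeafOK excl ok QB) roots`) for
  the matrix family `x ↦ QP (entries at x) m₀` (p1's `QP`), with the box-enclosure soundness `hQB` (p2/p5's
  θ-generic boxes), the excluder soundness `hexcl`, Hermitian-ness on `R` (`hH`), and the class-in-cover
  hypothesis `hcov` (p4's `admissible_coverHyp` / `coords_mem_rootBox`);
* the CONCLUSIONS: `le_C232T_of_cover : ∀ θ, Adm θ → m₀ ≤ C232T θ (c1T θ) (c2T θ)` (reduced form, the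
  N-15/T-chain functional) and `le_margin232LHS_of_cover : ∀ θ, Adm θ → m₀ + 2·10⁻⁵ ≤ margin232LHS θ …`
  (the object of record's own form), hence **`not_repairable_in_class_of_cover`**: if
  `0.001 ≤ m₀ + 2·10⁻⁵` then `∀ θ, Adm θ → ¬ Margin232T θ (c1T θ) (c2T θ)` — NOT-REPAIRABLE-IN-CLASS for the
  printed target — and `not_chain_repairable_of_cover` against the chain ceiling `25/3000`.

The `ι`-directions are eliminated exactly (PSD for all `x = (1, ι₂, ι₃, ι₄)`), so `Adm` may leave `ι ∈ ℂ³`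
free; only the real coordinates are covered. Pure logic over the landed frame; no numerics, no new
`Prop` facts, nothing about Theorems 1–2. Width-0 instance (TEAM R's regression target): `roots =
[(point box at θ₀'s coordinates, leaf)]` with `QB _ :=` the tables of `Section18AllIota` reproduces
`C232T_thetaIota_ge`.

## References

* Y. Zhang, arXiv:2211.02515v1 (2022), §2 (2.26), (2.32)–(2.33) [p. 10–11], §18 (18.1)–(18.2) and
  the assembly [p. 99]. [cite: Zhang2022LandauSiegel, §§2, 18]
* R. E. Moore, *Interval Analysis* (1966), §4.4. [Moore1966]
-/

noncomputable section

open Real Complex ComplexConjugate Matrix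
open scoped ComplexOrder
open Literature.Analysis.ValidatedNumerics (Box KdCert)
open Literature.Analysis.ValidatedNumerics.Numerics
open Literature.Analysis.ValidatedNumerics.IntervalGershgorin

namespace Literature.NumberTheory.LFunctions.Zhang2022

namespace Repair

/-! ### §1 The STRUCTURAL assembly (RULING R3, K-S4): dictionary identities + Cauchy–Schwarz -/

/-- **K-S4 core.** If on the class the three main-order functionals are dominated by / equal to values
of the ONE Hermitian form `𝔅` of the repair cell's dictionary — `𝔅(𝔤_θ,𝔤_θ) ≤ C₂₃₂(θ)` (K-S1/K-S2:
`Ξ₁/(𝔞𝔓)`), `𝔅(f_θ,f_θ) ≤ C₂₃₃(θ)` (K-S1: `Ξ_J/(𝔞𝔓)`), `|dSum(θ)| ≤ |P(𝔤_θ,f_θ)|` (K-S3: `Ξ₁*/(𝔞𝔓)`) —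
for `H¹` profiles `𝔤_θ, f_θ`, then the joint criterion T-true `C₂₃₂(θ)·C₂₃₃(θ) < |dSum(θ)|²` fails at
EVERY `θ` of the class (`MainTermFormCauchySchwarz.norm_sq_mainTermFormPolar_le`). The class predicate,
the functionals and the profiles are parameters: this is the shape p4's K-S4 statement instantiates.
[cite: Zhang2022LandauSiegel, §2 after (2.33)] -/
theorem normSq_dSum_le_of_domination {Θ : Type*} {Adm : Θ → Prop} {C232S C233S : Θ → ℝ} {dSumS : Θ → ℂ}
    {g g' f f' : Θ → ℝ → ℂ}
    (hg : ∀ θ, Adm θ → IsH1OnUnitInterval (g θ) (g' θ)) (hf : ∀ θ, Adm θ → IsH1OnUnitInterval (f θ) (f' θ))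
    (h232 : ∀ θ, Adm θ → mainTermForm (g θ) (g' θ) ≤ C232S θ)
    (h233 : ∀ θ, Adm θ → mainTermForm (f θ) (f' θ) ≤ C233S θ)
    (hd : ∀ θ, Adm θ → ‖dSumS θ‖ ≤ ‖mainTermFormPolar (g θ) (g' θ) (f θ) (f' θ)‖) :
    ∀ θ, Adm θ → ‖dSumS θ‖ ^ 2 ≤ C232S θ * C233S θ := by
  intro θ hθ
  have hcs := norm_sq_mainTermFormPolar_le (hg θ hθ) (hf θ hθ)
  have hBf := mainTermForm_nonneg_of_isH1 (hf θ hθ)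
  have hBg := mainTermForm_nonneg_of_isH1 (hg θ hθ)
  have hmono : mainTermForm (g θ) (g' θ) * mainTermForm (f θ) (f' θ) ≤ C232S θ * C233S θ :=
    mul_le_mul (h232 θ hθ) (h233 θ hθ) hBf (hBg.trans (h232 θ hθ))
  have hdd : ‖dSumS θ‖ ^ 2 ≤ ‖mainTermFormPolar (g θ) (g' θ) (f θ) (f' θ)‖ ^ 2 :=
    pow_le_pow_left₀ (norm_nonneg _) (hd θ hθ) 2
  exact hdd.trans (hcs.trans hmono)

/-- **NOT-REPAIRABLE-IN-CLASS, verdict currency (T-true), structural form**: under the dictionary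
hypotheses of `normSq_dSum_le_of_domination`, `¬ (C₂₃₂(θ)·C₂₃₃(θ) < |dSum(θ)|²)` for every `θ` in the
class — no cover, no `m₀`, any lengths/shifts/`ι` the class allows. [cite: Zhang2022LandauSiegel, §2 after (2.33)] -/
theorem not_trueNeed_of_domination {Θ : Type*} {Adm : Θ → Prop} {C232S C233S : Θ → ℝ}
    {dSumS : Θ → ℂ} {g g' f f' : Θ → ℝ → ℂ}
    (hg : ∀ θ, Adm θ → IsH1OnUnitInterval (g θ) (g' θ)) (hf : ∀ θ, Adm θ → IsH1OnUnitInterval (f θ) (f' θ))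
    (h232 : ∀ θ, Adm θ → mainTermForm (g θ) (g' θ) ≤ C232S θ)
    (h233 : ∀ θ, Adm θ → mainTermForm (f θ) (f' θ) ≤ C233S θ)
    (hd : ∀ θ, Adm θ → ‖dSumS θ‖ ≤ ‖mainTermFormPolar (g θ) (g' θ) (f θ) (f' θ)‖) :
    ∀ θ, Adm θ → ¬ (C232S θ * C233S θ < ‖dSumS θ‖ ^ 2) :=
  fun θ hθ h => absurd (normSq_dSum_le_of_domination hg hf h232 h233 hd θ hθ) (not_le.2 h)

/-- the same in the `√`-shape of `Section2MainOrder.MainOrderContradiction` /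
`Section2AllIota.MainOrderContradictionG` (`√(C₂₃₂C₂₃₃) < |𝔡′+𝔡|`), via
`MainTermFormCauchySchwarz.not_closing_of_isH1`. [cite: Zhang2022LandauSiegel, §2 after (2.33)] -/
theorem not_sqrt_closing_of_domination {Θ : Type*} {Adm : Θ → Prop} {C232S C233S : Θ → ℝ}
    {dSumS : Θ → ℂ} {g g' f f' : Θ → ℝ → ℂ}
    (hg : ∀ θ, Adm θ → IsH1OnUnitInterval (g θ) (g' θ)) (hf : ∀ θ, Adm θ → IsH1OnUnitInterval (f θ) (f' θ))
    (h232 : ∀ θ, Adm θ → mainTermForm (g θ) (g' θ) ≤ C232S θ)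
    (h233 : ∀ θ, Adm θ → mainTermForm (f θ) (f' θ) ≤ C233S θ)
    (hd : ∀ θ, Adm θ → ‖dSumS θ‖ ≤ ‖mainTermFormPolar (g θ) (g' θ) (f θ) (f' θ)‖) :
    ∀ θ, Adm θ → ¬ (Real.sqrt (C232S θ * C233S θ) < ‖dSumS θ‖) :=
  fun θ hθ => not_closing_of_isH1 (hg θ hθ) (hf θ hθ) (h232 θ hθ) (h233 θ hθ) (hd θ hθ)

/-- **[Q2-6] T-zero is impossible in class**: under the K-S1/K-S2 domination the (2.32)-side functional is
`≥ 0` at every `θ` of the class (`MainTermFormH1.mainTermForm_nonneg_of_isH1`).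
[cite: Zhang2022LandauSiegel, §2 (2.32), Lemma 2.3] -/
theorem C232S_nonneg_of_domination {Θ : Type*} {Adm : Θ → Prop} {C232S : Θ → ℝ} {g g' : Θ → ℝ → ℂ}
    (hg : ∀ θ, Adm θ → IsH1OnUnitInterval (g θ) (g' θ))
    (h232 : ∀ θ, Adm θ → mainTermForm (g θ) (g' θ) ≤ C232S θ) : ∀ θ, Adm θ → 0 ≤ C232S θ :=
  fun θ hθ => (mainTermForm_nonneg_of_isH1 (hg θ hθ)).trans (h232 θ hθ)

/-- **[Q2-1b] PRINTED-TRIPLE INFEASIBILITY**: under the dictionary hypotheses, the three printed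
numerical claims (2.32) `C₂₃₂ < 0.001`, (2.33) `C₂₃₃ < 3000` and Prop. 2.4 `|𝔡′+𝔡| > 5` cannot hold
together at ANY `θ` of the class (`0.001 · 3000 = 3 < 25`): the §2 chain (T-chain) is not re-instantiable
in class. [cite: Zhang2022LandauSiegel, §2 (2.32)–(2.33), Prop. 2.4] -/
theorem printedTriple_infeasible_of_domination {Θ : Type*} {Adm : Θ → Prop} {C232S C233S : Θ → ℝ}
    {dSumS : Θ → ℂ} {g g' f f' : Θ → ℝ → ℂ}
    (hg : ∀ θ, Adm θ → IsH1OnUnitInterval (g θ) (g' θ)) (hf : ∀ θ, Adm θ → IsH1OnUnitInterval (f θ) (f' θ))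
    (h232 : ∀ θ, Adm θ → mainTermForm (g θ) (g' θ) ≤ C232S θ)
    (h233 : ∀ θ, Adm θ → mainTermForm (f θ) (f' θ) ≤ C233S θ)
    (hd : ∀ θ, Adm θ → ‖dSumS θ‖ ≤ ‖mainTermFormPolar (g θ) (g' θ) (f θ) (f' θ)‖) :
    ∀ θ, Adm θ → ¬ (C232S θ < 0.001 ∧ C233S θ < 3000 ∧ 5 < ‖dSumS θ‖) := by
  intro θ hθ ⟨h1, h2, h3⟩
  have hcs := normSq_dSum_le_of_domination hg hf h232 h233 hd θ hθ
  have h0 : 0 ≤ C232S θ := (mainTermForm_nonneg_of_isH1 (hg θ hθ)).trans (h232 θ hθ)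
  have h0' : 0 ≤ C233S θ := (mainTermForm_nonneg_of_isH1 (hf θ hθ)).trans (h233 θ hθ)
  have h25 : (25 : ℝ) < ‖dSumS θ‖ ^ 2 := by nlinarith [norm_nonneg (dSumS θ)]
  have h3' : C232S θ * C233S θ ≤ 0.001 * 3000 := by nlinarith
  linarith

/-- **Width-0 regression target (TEAM R)**: on the printed `ι`-family the structural conclusion must
agree with the certified `Section2AllIota.not_mainOrderContradictionG_all`; this lemma records the
printed-family statement in the `Θ`-indexed shape above (`Θ = ℂ³`, class = everything), so that the
instantiated K-S4 theorem can be checked against it by `rfl` on the functionals.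
[cite: Zhang2022LandauSiegel, §2 after (2.33), (2.26)] -/
theorem printedFamily_not_sqrt_closing :
    ∀ w : ℂ × ℂ × ℂ, True →
      ¬ (Real.sqrt (C232G w.1 w.2.1 w.2.2 * C233) < ‖dprimeG w.2.1 + dfrakG w.1 w.2.1 w.2.2‖) :=
  fun w _ => (not_mainOrderContradictionG_all w.1 w.2.1 w.2.2).1

/-! ### §2 The LOCAL ANNEX (RULING R3, K-N): from a certified cover to floors of `C232T` / `margin232LHS` -/

/-- **Coordinate-level data of the §18 Hermitian form**: the nine entries of `RepairFormMatrix.QMOf`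
(the matrix constructor of record; `c₂₁ := conj c₁₂`, `c₄₄ := c₂₂`) as functions of the real
coordinates of `θ` (the `ι`'s do not enter). A plain record of functions — instantiated by the θ-generic
closed forms of p3/p4 (`c··`) and p1 (`F··T`, `R·T`) composed with the coordinate map.
[cite: Zhang2022LandauSiegel, (2.32), §18 (18.1)] -/
structure FormEntries where
  /-- `c₁₁(x)` (real) -/
  c11F : (ℕ → ℝ) → ℂ
  /-- `c₁₂(x)` -/
  c12F : (ℕ → ℝ) → ℂ
  /-- `c₂₂(x)` (real) -/
  c22F : (ℕ → ℝ) → ℂ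
  /-- `c₃₃(x)` (real) -/
  c33F : (ℕ → ℝ) → ℂ
  /-- `c₃₄(x)` (`c₄₄ := c₂₂`, (9.4): no separate slot, as in `RepairFormMatrix.QMOf`) -/
  c34F : (ℕ → ℝ) → ℂ
  /-- `F₂₀(x)` (for the unreduced form: `F₂₀ + R₃`) -/
  F20F : (ℕ → ℝ) → ℂ
  /-- `F₂₁(x)` -/
  F21F : (ℕ → ℝ) → ℂ
  /-- `F₃₀(x)` (for the unreduced form: `F₃₀ + R₄`) -/
  F30F : (ℕ → ℝ) → ℂ
  /-- `F₃₁(x)` -/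
  F31F : (ℕ → ℝ) → ℂ

/-- the matrix family `x ↦ QMOf(entries(x), m)` the cover certifies (p5's constructor of record; its box
layer is `RepairFormMatrix.QBoxOf`; `= QP … c22 …` of p1 by `RepairSection18Closed.QP_eq_QMOf`).
[cite: Zhang2022LandauSiegel, (2.32), §18] -/
def FormEntries.Q (E : FormEntries) (m : ℚ) (x : ℕ → ℝ) : Matrix (Fin 4) (Fin 4) ℂ :=
  QMOf (E.c11F x) (conj (E.c12F x)) (E.c12F x) (E.c22F x) (E.c33F x) (E.c34F x) (E.F20F x) (E.F21F x)
    (E.F30F x) (E.F31F x) m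

/-- **The feeders are the `§8/§9` Hermitian blocks of the entries** at `θ`'s coordinates (the hypotheses
`h1`, `h2` of p1's `C232T_form_re`, as a predicate on `(E, coords, c1T, c2T)`).
[cite: Zhang2022LandauSiegel, §8 after (8.23), §9 after (9.7)] -/
def FormEntries.Feeds (E : FormEntries) (coords : Theta → ℕ → ℝ) (c1T c2T : Theta → ℂ) : Prop :=
  ∀ θ, c1T θ = E.c11F (coords θ) + θ.iota2 * conj (E.c12F (coords θ)) + conj θ.iota2 * E.c12F (coords θ)
        + (Complex.normSq θ.iota2 : ℂ) * E.c22F (coords θ)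
    ∧ c2T θ = (Complex.normSq θ.iota3 : ℂ) * E.c33F (coords θ) + θ.iota3 * conj θ.iota4 * E.c34F (coords θ)
        + θ.iota4 * conj θ.iota3 * conj (E.c34F (coords θ)) + (Complex.normSq θ.iota4 : ℂ) * E.c22F (coords θ)

/-- **The (18.1) coefficients are p1's `F··T` at `θ`** (reduced form). [cite: Zhang2022LandauSiegel, §18 (18.1)–(18.2)] -/
def FormEntries.MatchesReduced (E : FormEntries) (coords : Theta → ℕ → ℝ) : Prop :=
  ∀ θ, E.F20F (coords θ) = F20T θ ∧ E.F21F (coords θ) = F21T θ ∧ E.F30F (coords θ) = F30T θ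
    ∧ E.F31F (coords θ) = F31T θ

/-- **The (18.1) coefficients are p1's `F₂₀+R₃, F₂₁, F₃₀+R₄, F₃₁` at `θ`** (unreduced form = the `𝔠₃` of
`Margin232T`). [cite: Zhang2022LandauSiegel, §18 (18.1)] -/
def FormEntries.MatchesUnreduced (E : FormEntries) (coords : Theta → ℕ → ℝ) : Prop :=
  ∀ θ, E.F20F (coords θ) = F20T θ + R3T θ ∧ E.F21F (coords θ) = F21T θ ∧ E.F30F (coords θ) = F30T θ + R4T θ
    ∧ E.F31F (coords θ) = F31T θ

/-- **A certified cover of the class** for the matrix family `Q`: root boxes with kd-certificates whose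
leaves pass `psdLeafOK`, an excluder sound against the region `R`, box enclosures `QB` sound for `Q` on
`R`, `Q` Hermitian on `R`, and every admissible `θ` covered with `R (coords θ)`.
[cite: Moore1966, §4.4] -/
structure CoverCertified (Adm : Theta → Prop) (coords : Theta → ℕ → ℝ)
    (Q : (ℕ → ℝ) → Matrix (Fin 4) (Fin 4) ℂ) : Prop where
  /-- the certificate exists and checks -/
  cert : ∃ (R : (ℕ → ℝ) → Prop) (excl ok : Box → Bool) (QB : Box → CMat 4)
      (roots : List (Box × KdCert (Option (PsdLeaf 4)))),
    coverCheck (psdLeafOK excl ok QB) roots = true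
    ∧ (∀ B, excl B = true → ∀ x, B.mem x → ¬ R x)
    ∧ (∀ B, ok B = true → ∀ x, B.mem x → R x → CMMem (Q x) (QB B))
    ∧ (∀ x, R x → (Q x)ᴴ = Q x)
    ∧ (∀ θ, Adm θ → CoverMem roots (coords θ) ∧ R (coords θ))

/-- **PSD on the class from a certified cover.** [cite: Moore1966, §4.4] -/
theorem CoverCertified.posSemidef {Adm : Theta → Prop} {coords : Theta → ℕ → ℝ}
    {Q : (ℕ → ℝ) → Matrix (Fin 4) (Fin 4) ℂ} (h : CoverCertified Adm coords Q) :
    ∀ θ, Adm θ → (Q (coords θ)).PosSemidef := by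
  obtain ⟨R, excl, ok, QB, roots, hchk, hexcl, hQB, hH, hcov⟩ := h.cert
  exact forall_class_of_cover roots hcov (posSemidef_of_coverCheck hexcl hQB hH hchk)

/-- **Reduced form: `∀ θ ∈ R, m₀ ≤ C₂₃₂(θ)`** from a certified cover of the reduced matrix family.
[cite: Zhang2022LandauSiegel, (2.32), §18] -/
theorem le_C232T_of_cover {Adm : Theta → Prop} {coords : Theta → ℕ → ℝ} {E : FormEntries}
    {c1T c2T : Theta → ℂ} {m₀ : ℚ} (hfeed : E.Feeds coords c1T c2T) (hF : E.MatchesReduced coords)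
    (hcov : CoverCertified Adm coords (E.Q m₀)) :
    ∀ θ, Adm θ → (m₀ : ℝ) ≤ C232T θ (c1T θ) (c2T θ) := by
  intro θ hθ
  have hpsd := hcov.posSemidef θ hθ
  obtain ⟨h20, h21, h30, h31⟩ := hF θ
  unfold FormEntries.Q at hpsd
  rw [h20, h21, h30, h31, ← QP_eq_QMOf] at hpsd
  exact C232T_ge_of_posSemidef θ (hfeed θ).1 (hfeed θ).2 hpsd

/-- **Unreduced form: `∀ θ ∈ R, m₀ + 2·10⁻⁵ ≤ margin232LHS(θ)`** from a certified cover of the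
unreduced matrix family (`F₂₀+R₃`, `F₃₀+R₄`). [cite: Zhang2022LandauSiegel, §18 p. 99] -/
theorem le_margin232LHS_of_cover {Adm : Theta → Prop} {coords : Theta → ℕ → ℝ} {E : FormEntries}
    {c1T c2T : Theta → ℂ} {m₀ : ℚ} (hfeed : E.Feeds coords c1T c2T) (hF : E.MatchesUnreduced coords)
    (hcov : CoverCertified Adm coords (E.Q m₀)) :
    ∀ θ, Adm θ → (m₀ : ℝ) + 2e-5 ≤ margin232LHS θ (c1T θ) (c2T θ) := by
  intro θ hθ
  have hpsd := hcov.posSemidef θ hθ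
  obtain ⟨h20, h21, h30, h31⟩ := hF θ
  unfold FormEntries.Q at hpsd
  rw [h20, h21, h30, h31, ← QP_eq_QMOf] at hpsd
  exact margin232LHS_ge_of_posSemidef θ (hfeed θ).1 (hfeed θ).2 hpsd

/-- **NOT-REPAIRABLE-IN-CLASS (printed target).** If the unreduced matrix family is certified PSD on the
class with `0.001 ≤ m₀ + 2·10⁻⁵`, the rung's margin functional `Margin232T` fails at EVERY admissible `θ`.
[cite: Zhang2022LandauSiegel, §18 p. 99] -/
theorem not_repairable_in_class_of_cover {Adm : Theta → Prop} {coords : Theta → ℕ → ℝ}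
    {E : FormEntries} {c1T c2T : Theta → ℂ} {m₀ : ℚ} (hfeed : E.Feeds coords c1T c2T)
    (hF : E.MatchesUnreduced coords) (hcov : CoverCertified Adm coords (E.Q m₀))
    (hm : (0.001 : ℝ) ≤ m₀ + 2e-5) :
    ∀ θ, Adm θ → ¬ Margin232T θ (c1T θ) (c2T θ) := by
  intro θ hθ hM
  have h := le_margin232LHS_of_cover hfeed hF hcov θ hθ
  unfold Margin232T at hM
  linarith

/-- **No admissible `θ` meets the chain ceiling `25/3000`** (reduced form) from a certified cover with
`25/3000 ≤ m₀`. [cite: Zhang2022LandauSiegel, §2 (2.32)–(2.33), §18 p. 99] -/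
theorem not_chain_repairable_of_cover {Adm : Theta → Prop} {coords : Theta → ℕ → ℝ}
    {E : FormEntries} {c1T c2T : Theta → ℂ} {m₀ : ℚ} (hfeed : E.Feeds coords c1T c2T)
    (hF : E.MatchesReduced coords) (hcov : CoverCertified Adm coords (E.Q m₀))
    (hm : (25 / 3000 : ℝ) ≤ m₀) :
    ∀ θ, Adm θ → ¬ (C232T θ (c1T θ) (c2T θ) < 25 / 3000) := by
  intro θ hθ hlt
  have h := le_C232T_of_cover hfeed hF hcov θ hθ
  linarith

/-- **Assembling a cover from pieces**: a cover of the CLASS may be the union of sub-covers (e.g. the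
printed-structure fibre handled by the exclusions of record and the complement handled by the kd-cover),
provided each admissible `θ` falls in one of them. [cite: Moore1966, §4.4] -/
theorem le_C232T_of_two_covers {Adm Adm₁ Adm₂ : Theta → Prop} {c1T c2T : Theta → ℂ} {m₁ m₂ m₀ : ℝ}
    (hsplit : ∀ θ, Adm θ → Adm₁ θ ∨ Adm₂ θ)
    (h₁ : ∀ θ, Adm₁ θ → m₁ ≤ C232T θ (c1T θ) (c2T θ)) (h₂ : ∀ θ, Adm₂ θ → m₂ ≤ C232T θ (c1T θ) (c2T θ))
    (hm₁ : m₀ ≤ m₁) (hm₂ : m₀ ≤ m₂) :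
    ∀ θ, Adm θ → m₀ ≤ C232T θ (c1T θ) (c2T θ) := by
  intro θ hθ
  rcases hsplit θ hθ with h | h
  · exact hm₁.trans (h₁ θ h)
  · exact hm₂.trans (h₂ θ h)

/-- **The printed `ι`-family as a degenerate sub-cover**: on `{thetaIota w | w ∈ ℂ³}` the floor
`0.03095` of `Section18AllIota` holds for `C232T` fed with the printed-structure feeders (p1's
`C232T_thetaIota_ge`), in the shape `le_C232T_of_two_covers` consumes.
[cite: Zhang2022LandauSiegel, (2.26), (2.32), §18] -/
theorem le_C232T_on_iota_family :
    ∀ θ, (∃ w2 w3 w4 : ℂ, θ = thetaIota w2 w3 w4) →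
      (0.03095 : ℝ) ≤ C232T θ (frakc1G θ.iota2) (frakc2G θ.iota3 θ.iota4) := by
  rintro θ ⟨w2, w3, w4, rfl⟩
  rw [thetaIota_iota2, thetaIota_iota3, thetaIota_iota4]
  exact C232T_thetaIota_ge w2 w3 w4

end Repair

end Literature.NumberTheory.LFunctions.Zhang2022
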